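import Mathlib
import HarnessLib
import Summits.CriticalPhenomena.Ising3DConformalLimit.Theses.HyperoctahedralRP
import Summits.CriticalPhenomena.Ising3DConformalLimit.Theorems.HyperoctahedralRPTwoPointKernelOfLimitClauses
import Summits.CriticalPhenomena.Ising3DConformalLimit.Theorems.HyperoctahedralRPCriticalCorrNineMirrorRP

/-!
# The two-point kernel of a pointwise scaling limit of the critical `ℤ³` Ising correlators, II:
# the glue `TwoPointKernelOfLimit`
(route HyperoctahedralRP, item stmt-CriticalPhenomena-1983, proved here on the way to the milestone
`TwoPointLimitIsotropic`, item stmt-CriticalPhenomena-1984)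

For every non-degenerate, translation-invariant, scale-covariant pointwise scaling limit `S` of the
critical `ℤ³` Ising correlators (renormalisation `ρ > 0` on `(0,1]`), the kernel `K x = S 2 (0, x)`
satisfies the hypotheses of the crux `HRP2Rigidity`: window `1/2 ≤ Δ ≤ 1`, continuity and positivity
off `0`, homogeneity of degree `-2Δ`, invariance AND reflection positivity with respect to the nine
lattice mirrors `e_i, e_i ± e_j` (`twoPointKernelOfLimit_proof`, literally the route decl
`TwoPointKernelOfLimit`). Clauses (a)–(e) and the limit passage for (f) are in
`…HyperoctahedralRPTwoPointKernelOfLimitClauses`; here the nine lattice mirrors of `ℤ³` are matched with the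
continuum reflections (`siteVec_coordMirror`, `siteVec_swapMirror`, `siteVec_antiMirror`, and the
integer levels `level_*`), the two-point case of the nine-mirror lattice reflection positivity is
extracted (`latticeRP_two_of_nine`) from `CriticalCorrNineMirrorRP` (item stmt-1985, proved in
`…HyperoctahedralRPCriticalCorrNineMirrorRP`), and everything is assembled
(`twoPointKernelOfLimit_of_nineMirrorRP`, `twoPointKernelOfLimit_proof`). Translation invariance of
`S`, a hypothesis of the route decl, is not used (it is automatic for a limit).

References: J. Fröhlich, R. Israel, E. H. Lieb, B. Simon, Comm. Math. Phys. 62 (1978), §3 Thm. 3.1;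
J. Glimm, A. Jaffe, *Quantum Physics* (1987), §10.4; A. Björner, F. Brenti (2005), §8.1.
No definitions are introduced.
-/

noncomputable section

namespace Summit.CriticalPhenomena.Ising3DConformalLimit.HyperoctahedralRPTwoPoint

open Literature.Probability.LatticeModels Literature.MathematicalPhysics.QuantumFieldTheory
open Filter Set
open scoped Topology InnerProductSpace
open Summit.CriticalPhenomena.Ising3DConformalLimit.MoebiusLimitExistsNegative
open Summit.CriticalPhenomena.Ising3DConformalLimit.RotationUpgradeFromTwoPointNegative

variable {ρ : ℝ → ℝ} {Δ : ℝ} {S : CorrFamily 3}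
/-! ### The nine lattice mirrors of `ℤ³` -/

/-- Coordinate mirror of `ℤ³`: `siteVec (θ_i y) = θ_{e_i} (siteVec y)`. [folklore] -/
theorem siteVec_coordMirror (i : Fin 3) (y : Site 3) :
    siteVec (Function.update y i (-y i)) =
      (ℝ ∙ EuclideanSpace.single i (1:ℝ))ᗮ.reflection (siteVec y) := by
  ext l
  rw [siteVec_apply, reflection_single_apply, siteVec_apply]
  by_cases hl : l = i
  · subst hl; simp
  · simp [hl]

/-- Diagonal mirror of `ℤ³` (swap): `siteVec (y ∘ swap i j) = θ_{e_i - e_j} (siteVec y)`. [folklore] -/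
theorem siteVec_swapMirror {i j : Fin 3} (hij : i ≠ j) (y : Site 3) :
    siteVec (y ∘ Equiv.swap i j) =
      (ℝ ∙ (EuclideanSpace.single i (1:ℝ) - EuclideanSpace.single j 1))ᗮ.reflection (siteVec y) := by
  ext l
  rw [siteVec_apply, reflection_single_sub_single_apply hij, siteVec_apply, Function.comp_apply]

/-- Anti-diagonal mirror of `ℤ³`: `siteVec (θ y) = θ_{e_i + e_j} (siteVec y)` for
`θ y = (y with y_i ↦ -y_j, y_j ↦ -y_i)`. [folklore] -/
theorem siteVec_antiMirror {i j : Fin 3} (hij : i ≠ j) (y : Site 3) :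
    siteVec (Function.update (Function.update y i (-y j)) j (-y i)) =
      (ℝ ∙ (EuclideanSpace.single i (1:ℝ) + EuclideanSpace.single j 1))ᗮ.reflection (siteVec y) := by
  ext l
  rw [siteVec_apply, reflection_single_add_single_apply hij, siteVec_apply, siteVec_apply,
    siteVec_apply]
  by_cases hli : l = i
  · subst hli
    simp [hij]
  · by_cases hlj : l = j
    · subst hlj
      simp [hli]
    · simp [hli, hlj]

/-- Level of the coordinate mirror: `y_i = ⟪siteVec y, e_i⟫`. [folklore] -/
theorem level_coordMirror (i : Fin 3) (y : Site 3) :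
    ((y i : ℤ) : ℝ) = ⟪siteVec y, EuclideanSpace.single i (1:ℝ)⟫_ℝ := by
  rw [← real_inner_comm (siteVec y), inner_single_one_left, siteVec_apply]

/-- Level of the diagonal mirror: `y_i - y_j = ⟪siteVec y, e_i - e_j⟫`. [folklore] -/
theorem level_swapMirror (i j : Fin 3) (y : Site 3) :
    ((y i - y j : ℤ) : ℝ) = ⟪siteVec y, EuclideanSpace.single i (1:ℝ) - EuclideanSpace.single j 1⟫_ℝ := by
  rw [← real_inner_comm (siteVec y), inner_single_sub_single_left, siteVec_apply, siteVec_apply]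
  push_cast
  ring

/-- Level of the anti-diagonal mirror: `y_i + y_j = ⟪siteVec y, e_i + e_j⟫`. [folklore] -/
theorem level_antiMirror (i j : Fin 3) (y : Site 3) :
    ((y i + y j : ℤ) : ℝ) = ⟪siteVec y, EuclideanSpace.single i (1:ℝ) + EuclideanSpace.single j 1⟫_ℝ := by
  rw [← real_inner_comm (siteVec y), inner_single_add_single_left, siteVec_apply, siteVec_apply]
  push_cast
  ring

/-- Two singleton configurations concatenate to a pair. [folklore] -/
theorem append_one_one (u v : Site 3) :
    Fin.append (fun _ : Fin 1 => u) (fun _ : Fin 1 => v) = ![u, v] := by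
  funext l
  fin_cases l
  · exact Fin.append_left (fun _ : Fin 1 => u) (fun _ : Fin 1 => v) 0
  · exact Fin.append_right (fun _ : Fin 1 => u) (fun _ : Fin 1 => v) 0

/-- The two-point (all `k_a = 1`) case of the nine-mirror lattice reflection positivity
`CriticalCorrNineMirrorRP`. [cite: FrohlichEtAl1978, §3 Thm 3.1] -/
theorem latticeRP_two_of_nine
    (hNine : Summit.CriticalPhenomena.Ising3DConformalLimit.Theses.HyperoctahedralRP.CriticalCorrNineMirrorRP)
    (θ' : Site 3 → Site 3) (ℓ : Site 3 → ℤ)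
    (hθℓ : ∃ i j : Fin 3, i ≠ j ∧ ((θ' = fun x => Function.update x i (-x i)) ∧ (ℓ = fun x => x i) ∨
      (θ' = fun x => x ∘ Equiv.swap i j) ∧ (ℓ = fun x => x i - x j) ∨
      (θ' = fun x => Function.update (Function.update x i (-x j)) j (-x i)) ∧ (ℓ = fun x => x i + x j)))
    (m : ℕ) (y : Fin m → Site 3) (c : Fin m → ℝ) (hy : ∀ a, 0 < ℓ (y a)) :
    0 ≤ ∑ a, ∑ b, c a * c b * criticalCorr 3 2 ![θ' (y a), y b] := by
  have h := hNine θ' ℓ hθℓ m (fun _ => 1) (fun a _ => y a) c (fun a _ => hy a)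
  have hconv : ∀ a b, criticalCorr 3 (1 + 1)
      (Fin.append (fun _ : Fin 1 => θ' (y a)) (fun _ : Fin 1 => y b)) =
      criticalCorr 3 2 ![θ' (y a), y b] := fun a b => by
    rw [append_one_one]
  simpa only [hconv] using h

/-! ### Assembly of the glue -/

open Summit.CriticalPhenomena.Ising3DConformalLimit.Theses.HyperoctahedralRP in
/-- Invariance and reflection positivity of the kernel `x ↦ S 2 (0, x)` with respect to the nine
lattice mirrors, for ANY pointwise scaling limit `S` of `criticalCorr 3` (any renormalisation; no
non-degeneracy, translation invariance or scale covariance needed), granted the nine-mirror lattice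
reflection positivity `CriticalCorrNineMirrorRP`. [cite: FrohlichEtAl1978, §3 Thm 3.1] -/
theorem kernel_nineMirror_of_nineMirrorRP (hNine : CriticalCorrNineMirrorRP)
    (hlim : HasPointwiseScalingLimit (criticalCorr 3) ρ S) {n : EuclideanSpace ℝ (Fin 3)}
    (hn : ∃ i j : Fin 3, i ≠ j ∧ (n = EuclideanSpace.single i 1 ∨
      n = EuclideanSpace.single i 1 + EuclideanSpace.single j 1 ∨
      n = EuclideanSpace.single i 1 - EuclideanSpace.single j 1)) :
    (∀ x : EuclideanSpace ℝ (Fin 3), S 2 ![0, (ℝ ∙ n)ᗮ.reflection x] = S 2 ![0, x]) ∧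
    (∀ (m : ℕ) (p : Fin m → EuclideanSpace ℝ (Fin 3)) (c : Fin m → ℝ), (∀ a, 0 < inner ℝ (p a) n) →
      0 ≤ ∑ a, ∑ b, c a * c b * S 2 ![0, p a - (ℝ ∙ n)ᗮ.reflection (p b)]) := by
  refine ⟨kernel_mirror_invariant hlim hn, ?_⟩
  obtain ⟨i, j, hij, rfl | rfl | rfl⟩ := hn
  · exact kernel_mirrorRP_of_latticeRP hlim _ (fun y => Function.update y i (-y i)) (fun y => y i)
      (siteVec_coordMirror i) (level_coordMirror i)
      (latticeRP_two_of_nine hNine _ _ ⟨i, j, hij, Or.inl ⟨rfl, rfl⟩⟩)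
  · exact kernel_mirrorRP_of_latticeRP hlim _
      (fun y => Function.update (Function.update y i (-y j)) j (-y i)) (fun y => y i + y j)
      (siteVec_antiMirror hij) (level_antiMirror i j)
      (latticeRP_two_of_nine hNine _ _ ⟨i, j, hij, Or.inr (Or.inr ⟨rfl, rfl⟩)⟩)
  · exact kernel_mirrorRP_of_latticeRP hlim _ (fun y => y ∘ Equiv.swap i j) (fun y => y i - y j)
      (siteVec_swapMirror hij) (level_swapMirror i j)
      (latticeRP_two_of_nine hNine _ _ ⟨i, j, hij, Or.inr (Or.inl ⟨rfl, rfl⟩)⟩)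

open Summit.CriticalPhenomena.Ising3DConformalLimit.Theses.HyperoctahedralRP in
/-- **`TwoPointKernelOfLimit` from the nine-mirror lattice reflection positivity.** For every
non-degenerate, translation-invariant, scale-covariant pointwise scaling limit `S` of the critical
`ℤ³` Ising correlators (renormalisation `ρ > 0` on `(0,1]`), the kernel `K x = S 2 (0, x)` lies in
the window `1/2 ≤ Δ ≤ 1`, is continuous and positive off `0`, homogeneous of degree `-2Δ`,
invariant under the nine lattice mirrors, and — granted `CriticalCorrNineMirrorRP` (item
stmt-1985, FILS 1978) — reflection positive with respect to each of them. Translation invariance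
of `S` is not used (it is automatic for a limit). [cite: FrohlichEtAl1978, §3 Thm 3.1] -/
theorem twoPointKernelOfLimit_of_nineMirrorRP (hNine : CriticalCorrNineMirrorRP) :
    TwoPointKernelOfLimit := by
  intro ρ Δ S hρ hlim hnd _htr hsc
  exact ⟨window hρ hlim hnd hsc, kernel_continuousOn hlim, kernel_pos hnd,
    kernel_homogeneous hsc, fun n hn => kernel_nineMirror_of_nineMirrorRP hNine hlim hn⟩

open Summit.CriticalPhenomena.Ising3DConformalLimit.Theses.HyperoctahedralRP
  Summit.CriticalPhenomena.Ising3DConformalLimit.HyperoctahedralRPNineMirror in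
/-- **`TwoPointKernelOfLimit`** (item stmt-CriticalPhenomena-1983), unconditionally: the glue from
the nine-mirror lattice reflection positivity (`twoPointKernelOfLimit_of_nineMirrorRP`) and the
proof of that lattice input (`criticalCorrNineMirrorRP_proof`, FILS 1978).
[cite: FrohlichEtAl1978, §3 Thm 3.1] -/
theorem twoPointKernelOfLimit_proof : TwoPointKernelOfLimit :=
  twoPointKernelOfLimit_of_nineMirrorRP criticalCorrNineMirrorRP_proof

open Summit.CriticalPhenomena.Ising3DConformalLimit.HyperoctahedralRPNineMirror in
/-- **The two-point kernel of ANY pointwise scaling limit of the critical `ℤ³` Ising correlators is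
invariant and reflection positive (`IsMirrorRPKernel`, Osterwalder–Schrader positivity on point
masses) with respect to each of the nine lattice mirrors `e_i, e_i ± e_j`** — whatever the
renormalisation, with no non-degeneracy or covariance hypothesis: lattice reflection positivity
(FILS 1978) passes to every scaling limit. [cite: FrohlichEtAl1978, §3 Thm 3.1] -/
theorem kernel_nineMirror (hlim : HasPointwiseScalingLimit (criticalCorr 3) ρ S)
    {n : EuclideanSpace ℝ (Fin 3)} (hn : n ∈ latticeMirrorNormals (Fin 3)) :
    (∀ x : EuclideanSpace ℝ (Fin 3), S 2 ![0, (ℝ ∙ n)ᗮ.reflection x] = S 2 ![0, x]) ∧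
      IsMirrorRPKernel n (fun x : EuclideanSpace ℝ (Fin 3) => S 2 ![0, x]) :=
  kernel_nineMirror_of_nineMirrorRP criticalCorrNineMirrorRP_proof hlim
    ((mem_latticeMirrorNormals_iff n).1 hn)

end Summit.CriticalPhenomena.Ising3DConformalLimit.HyperoctahedralRPTwoPoint

end
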